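import Summits.KontsevichZagierPeriods.KontsevichZagierPeriods.Theses.HurwitzMicroSectors
import Summits.KontsevichZagierPeriods.KontsevichZagierPeriods.Theorems.HurwitzMicroSectorsNormalFormPrinciplePiBoxTransfer
import Summits.KontsevichZagierPeriods.KontsevichZagierPeriods.Theorems.HurwitzMicroSectorsNormalFormPrincipleVariants2204
import Summits.KontsevichZagierPeriods.KontsevichZagierPeriods.Theorems.HurwitzMicroSectorsNormalFormPrincipleVariants2217

/-! TTRL-lite variant V2273 of stmt-KontsevichZagierPeriods-3869

Variant V2273 = `stub_boxRigidity` (the leaf `BoxRigidity` of `NormalFormPrinciple`: two representations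
on open unit boxes with integrands of KZ's rational shape `p/q`, `p, q` over `ℚ`, and equal values are
KZ-equivalent) under the JOINT small-case move `bound_nat:m≤4; bound_nat:m'≤4`. Verdict of the attempt
seat: **open** — this file is the exact-strength certificate, not a proof of the variant.
* `stub_boxRigidity_var2273_iff_boxVanishing_four`: V2273 ⟺ **BoxVanishing 4** — every box-rational
  representation on `(0,1)⁴` of value `0` is a relation (`boxRigidityLe_iff_boxVanishing 4 4`, file
  `…Variants2239`: pad both representations to the common `4`-box and subtract there one way, compare
  with the zero representation on the `0`-box the other way);
* `stub_boxRigidity_var2273_iff_var2217`: V2273 is VERBATIM the right-hand side of the tree theorem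
  `stub_boxRigidity_var2217_iff_le_four`, so it coincides with the siblings V2217 (`m ≤ 2, m' ≤ 4`),
  V2216 (`m = 2, m' ≤ 4`) and V2215 (`m = 2, m' = 4`) — every two-sided sibling of maximum dimension `4`;
* `boxVanishing_le_four_of_stub_boxRigidity_var2273`, `sectorTwo_of_stub_boxRigidity_var2273`,
  `catalanSector_unconditional_of_stub_boxRigidity_var2273`: V2273 contains BoxVanishing in every
  dimension `≤ 4`, hence Conjecture 1 on EVERY weight-two Hurwitz sector `P(xy)/(1 − (xy)ᴸ)` of the
  square with no linear-independence input — in particular the level-`4` (Catalan) rung, which the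
  route closes only under the open hypothesis `Indep_ℚ(1, π², G)`; nothing in the tree or in print
  proves BoxVanishing 2, let alone 4 (`ζ(3)`, `π⁴` versus `ζ(4)`, `Li_k` at rationals, …);
* the only slice that IS a theorem of the tree is `m, m' ≤ 1` (`boxRigidity_of_le_one`, Baker's theorem
  on linear forms in logarithms; landed verbatim as `stub_boxRigidity_var2229_slice_le_one`, file
  `…Variants2229`, not restated here);
* `stub_boxRigidity_var2273_of_parent` / `_of_statement`: Summit ⇒ parent ⇒ V2273, so a refutation of
  the variant would refute Conjecture 1 for the tree's calculus (`IntegralRep` carries `integrableOn`,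
  no junk-value witness; no invariant of the four moves beyond `eval` is known).
Residual goal (the variant CLOSED MODULO it, `stub_boxRigidity_var2273_of_boxVanishing_four`):
`∀ M : IntegralRep 4, M.domain = box → M.IsRational → M.value = 0 → of M ∈ relations`.
Source: M. Kontsevich, D. Zagier, *Periods* (2001), §1.2 Conjecture 1 and rules 1)–3).
Pure proof file, no definitions. -/

-- `Summit.<Summit>.<Problem>` is the tree's mandated summit-side namespace (CONVENTIONS §2); for this
-- single-conjunct summit the two coincide, so the duplicate is deliberate.
set_option linter.dupNamespace false

noncomputable section

namespace Summit.KontsevichZagierPeriods.KontsevichZagierPeriods.Theorems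

open MeasureTheory Set
open Literature.NumberTheory.Transcendental Literature.NumberTheory.Transcendental.KZ
open Summit.KontsevichZagierPeriods.KontsevichZagierPeriods.Theses.HurwitzMicroSectors
open Summit.KontsevichZagierPeriods.HurwitzMicroSectors.NormalFormPrinciple.PiBox

/-! ## The variant V2273: exactly `BoxVanishing 4` -/

/-- **V2273 ⟺ `BoxVanishing 4`**: the joint bound `m ≤ 4, m' ≤ 4` is the single dimension
`max 4 4 = 4` (`boxRigidityLe_iff_boxVanishing 4 4`). [cite: KontsevichZagier2001, §1.2 Conjecture 1] -/
theorem stub_boxRigidity_var2273_iff_boxVanishing_four :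
    (∀ (m m' : ℕ) (N : IntegralRep m) (N' : IntegralRep m'), m' ≤ 4 → m ≤ 4 → N.domain = {x | ∀ i, x i ∈ Set.Ioo (0:ℝ) 1} → N.IsRational → N'.domain = {x | ∀ i, x i ∈ Set.Ioo (0:ℝ) 1} → N'.IsRational → N.value = N'.value → Equivalent N N') ↔
    (∀ (M : IntegralRep 4), M.domain = {x | ∀ i, x i ∈ Set.Ioo (0:ℝ) 1} → M.IsRational →
      M.value = 0 → of M ∈ relations) :=
  boxRigidityLe_iff_boxVanishing 4 4

/-- **V2273 under `BoxVanishing 4` as a hypothesis** (the variant CLOSED MODULO its residual goal,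
stated verbatim): this is the exact missing input. [cite: KontsevichZagier2001, §1.2 Conjecture 1] -/
theorem stub_boxRigidity_var2273_of_boxVanishing_four
    (hvan : ∀ (M : IntegralRep 4), M.domain = {x | ∀ i, x i ∈ Set.Ioo (0:ℝ) 1} → M.IsRational →
      M.value = 0 → of M ∈ relations) :
    ∀ (m m' : ℕ) (N : IntegralRep m) (N' : IntegralRep m'), m' ≤ 4 → m ≤ 4 → N.domain = {x | ∀ i, x i ∈ Set.Ioo (0:ℝ) 1} → N.IsRational → N'.domain = {x | ∀ i, x i ∈ Set.Ioo (0:ℝ) 1} → N'.IsRational → N.value = N'.value → Equivalent N N' :=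
  stub_boxRigidity_var2273_iff_boxVanishing_four.2 hvan

/-- **V2273 ⟺ the sibling V2217** (`bound_nat:m≤2; bound_nat:m'≤4`): V2273 is verbatim the right-hand
side of `stub_boxRigidity_var2217_iff_le_four` — the bound `m ≤ 2` versus `m ≤ 4` is idle next to
`m' ≤ 4`, both being `BoxVanishing 4`. [cite: KontsevichZagier2001, §1.2 Conjecture 1] -/
theorem stub_boxRigidity_var2273_iff_var2217 :
    (∀ (m m' : ℕ) (N : IntegralRep m) (N' : IntegralRep m'), m' ≤ 4 → m ≤ 4 → N.domain = {x | ∀ i, x i ∈ Set.Ioo (0:ℝ) 1} → N.IsRational → N'.domain = {x | ∀ i, x i ∈ Set.Ioo (0:ℝ) 1} → N'.IsRational → N.value = N'.value → Equivalent N N') ↔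
    (∀ (m m' : ℕ) (N : IntegralRep m) (N' : IntegralRep m'), m' ≤ 4 → m ≤ 2 →
      N.domain = {x | ∀ i, x i ∈ Set.Ioo (0:ℝ) 1} → N.IsRational →
      N'.domain = {x | ∀ i, x i ∈ Set.Ioo (0:ℝ) 1} → N'.IsRational →
      N.value = N'.value → Equivalent N N') :=
  stub_boxRigidity_var2217_iff_le_four.symm

/-- **V2273 is symmetric in the two bounds** (read the hypotheses in the order `m ≤ 4 → m' ≤ 4`; the
same statement, recorded so that the mirrored machine move is recognised as this one).
[cite: KontsevichZagier2001, §1.2 Conjecture 1] -/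
theorem stub_boxRigidity_var2273_iff_mirror :
    (∀ (m m' : ℕ) (N : IntegralRep m) (N' : IntegralRep m'), m' ≤ 4 → m ≤ 4 → N.domain = {x | ∀ i, x i ∈ Set.Ioo (0:ℝ) 1} → N.IsRational → N'.domain = {x | ∀ i, x i ∈ Set.Ioo (0:ℝ) 1} → N'.IsRational → N.value = N'.value → Equivalent N N') ↔
    (∀ (m m' : ℕ) (N : IntegralRep m) (N' : IntegralRep m'), m ≤ 4 → m' ≤ 4 →
      N.domain = {x | ∀ i, x i ∈ Set.Ioo (0:ℝ) 1} → N.IsRational →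
      N'.domain = {x | ∀ i, x i ∈ Set.Ioo (0:ℝ) 1} → N'.IsRational →
      N.value = N'.value → Equivalent N N') :=
  ⟨fun h m m' N N' hm hm' => h m m' N N' hm' hm, fun h m m' N N' hm' hm => h m m' N N' hm hm'⟩

/-! ## What V2273 contains -/

/-- **V2273 ⇒ `BoxVanishing` in every dimension `≤ 4`** (monotonicity along padding,
`boxVanishing_mono`): in particular the open dimension-`2` and dimension-`3` vanishing statements for
box-rational periods. [cite: KontsevichZagier2001, §1.2 Conjecture 1] -/
theorem boxVanishing_le_four_of_stub_boxRigidity_var2273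
    (h : ∀ (m m' : ℕ) (N : IntegralRep m) (N' : IntegralRep m'), m' ≤ 4 → m ≤ 4 → N.domain = {x | ∀ i, x i ∈ Set.Ioo (0:ℝ) 1} → N.IsRational → N'.domain = {x | ∀ i, x i ∈ Set.Ioo (0:ℝ) 1} → N'.IsRational → N.value = N'.value → Equivalent N N')
    {j : ℕ} (hj : j ≤ 4) (N : IntegralRep j) (hNd : N.domain = {x | ∀ i, x i ∈ Set.Ioo (0:ℝ) 1})
    (hNr : N.IsRational) (hv : N.value = 0) : of N ∈ relations :=
  boxVanishing_mono hj (stub_boxRigidity_var2273_iff_boxVanishing_four.1 h) N hNd hNr hv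

/-- **V2273 ⇒ V2204** (`fix_nat:m=2; bound_nat:m'≤2`, i.e. `BoxVanishing 2`): restrict both
dimensions to `≤ 2`. [cite: KontsevichZagier2001, §1.2 Conjecture 1] -/
theorem stub_boxRigidity_var2204_of_var2273
    (h : ∀ (m m' : ℕ) (N : IntegralRep m) (N' : IntegralRep m'), m' ≤ 4 → m ≤ 4 → N.domain = {x | ∀ i, x i ∈ Set.Ioo (0:ℝ) 1} → N.IsRational → N'.domain = {x | ∀ i, x i ∈ Set.Ioo (0:ℝ) 1} → N'.IsRational → N.value = N'.value → Equivalent N N') :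
    ∀ (m' : ℕ) (N : IntegralRep 2) (N' : IntegralRep m'), m' ≤ 2 → N.domain = {x | ∀ i, x i ∈ Set.Ioo (0:ℝ) 1} → N.IsRational → N'.domain = {x | ∀ i, x i ∈ Set.Ioo (0:ℝ) 1} → N'.IsRational → N.value = N'.value → Equivalent N N' :=
  fun m' N N' hm' => h 2 m' N N' (hm'.trans (by norm_num)) (by norm_num)

/-- **V2273 ⇒ Conjecture 1 on every weight-two Hurwitz sector of the square**: two representations on
`(0,1)²` with integrands `P(xy)/(1 − (xy)ᴸ)`, `P'(xy)/(1 − (xy)ᴸ)` (`L ≠ 0`) and equal values are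
KZ-equivalent, with NO linear-independence input (the route closes such rungs one level at a time and
only given the matching independence theorem). [cite: KontsevichZagier2001, §1.2 Conjecture 1] -/
theorem sectorTwo_of_stub_boxRigidity_var2273
    (h : ∀ (m m' : ℕ) (N : IntegralRep m) (N' : IntegralRep m'), m' ≤ 4 → m ≤ 4 → N.domain = {x | ∀ i, x i ∈ Set.Ioo (0:ℝ) 1} → N.IsRational → N'.domain = {x | ∀ i, x i ∈ Set.Ioo (0:ℝ) 1} → N'.IsRational → N.value = N'.value → Equivalent N N')
    (L : ℕ) (hL : L ≠ 0) :
    ∀ (r r' : IntegralRep 2) (P P' : Polynomial ℚ), r.domain = {x | ∀ i, x i ∈ Set.Ioo (0:ℝ) 1} →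
      r'.domain = {x | ∀ i, x i ∈ Set.Ioo (0:ℝ) 1} →
      EqOn r.integrand (fun x => Polynomial.aeval (x 0 * x 1) P / (1 - (x 0 * x 1) ^ L)) r.domain →
      EqOn r'.integrand (fun x => Polynomial.aeval (x 0 * x 1) P' / (1 - (x 0 * x 1) ^ L)) r'.domain →
      r.value = r'.value → Equivalent r r' :=
  sectorTwo_of_stub_boxRigidity_var2204 (stub_boxRigidity_var2204_of_var2273 h) L hL

/-- **V2273 ⇒ the Catalan rung unconditionally**: the CONCLUSION of the route item
`CatalanSectorTwoFour` (level `4`, weight `2`) without its open hypothesis `Indep_ℚ(1, π², G)`.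
[cite: KontsevichZagier2001, §1.2 Conjecture 1] -/
theorem catalanSector_unconditional_of_stub_boxRigidity_var2273
    (h : ∀ (m m' : ℕ) (N : IntegralRep m) (N' : IntegralRep m'), m' ≤ 4 → m ≤ 4 → N.domain = {x | ∀ i, x i ∈ Set.Ioo (0:ℝ) 1} → N.IsRational → N'.domain = {x | ∀ i, x i ∈ Set.Ioo (0:ℝ) 1} → N'.IsRational → N.value = N'.value → Equivalent N N') :
    ∀ (r r' : IntegralRep 2) (P P' : Polynomial ℚ), r.domain = {x | ∀ i, x i ∈ Set.Ioo (0:ℝ) 1} →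
      r'.domain = {x | ∀ i, x i ∈ Set.Ioo (0:ℝ) 1} →
      EqOn r.integrand (fun x => Polynomial.aeval (x 0 * x 1) P / (1 - (x 0 * x 1) ^ 4)) r.domain →
      EqOn r'.integrand (fun x => Polynomial.aeval (x 0 * x 1) P' / (1 - (x 0 * x 1) ^ 4)) r'.domain →
      r.value = r'.value → Equivalent r r' :=
  catalanSector_unconditional_of_stub_boxRigidity_var2204 (stub_boxRigidity_var2204_of_var2273 h)

/-! ## Where V2273 sits under the Summit -/

/-- **The parent leaf ⇒ V2273** (specialisation; the converse is not claimed — the parent is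
`BoxVanishing` in ALL dimensions, the variant only in dimension `4`). [cite: KontsevichZagier2001, §1.2 Conjecture 1] -/
theorem stub_boxRigidity_var2273_of_parent
    (h : ∀ (m m' : ℕ) (N : IntegralRep m) (N' : IntegralRep m'), N.domain = {x | ∀ i, x i ∈ Set.Ioo (0:ℝ) 1} → N.IsRational → N'.domain = {x | ∀ i, x i ∈ Set.Ioo (0:ℝ) 1} → N'.IsRational → N.value = N'.value → Equivalent N N') :
    ∀ (m m' : ℕ) (N : IntegralRep m) (N' : IntegralRep m'), m' ≤ 4 → m ≤ 4 → N.domain = {x | ∀ i, x i ∈ Set.Ioo (0:ℝ) 1} → N.IsRational → N'.domain = {x | ∀ i, x i ∈ Set.Ioo (0:ℝ) 1} → N'.IsRational → N.value = N'.value → Equivalent N N' :=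
  fun m m' N N' _ _ => h m m' N N'

/-- **`KontsevichZagierPeriods ⇒ V2273`**: the variant is a special case of Conjecture 1 for the tree's
calculus (`leaves_of_statement`) — so a refutation of the variant would refute the Summit.
[cite: KontsevichZagier2001, §1.2 Conjecture 1] -/
theorem stub_boxRigidity_var2273_of_statement (h : _root_.KontsevichZagierPeriods) :
    ∀ (m m' : ℕ) (N : IntegralRep m) (N' : IntegralRep m'), m' ≤ 4 → m ≤ 4 → N.domain = {x | ∀ i, x i ∈ Set.Ioo (0:ℝ) 1} → N.IsRational → N'.domain = {x | ∀ i, x i ∈ Set.Ioo (0:ℝ) 1} → N'.IsRational → N.value = N'.value → Equivalent N N' :=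
  stub_boxRigidity_var2273_of_parent (leaves_of_statement h).1

end Summit.KontsevichZagierPeriods.KontsevichZagierPeriods.Theorems

end
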